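import Summits.CriticalPhenomena.CardyFormulaZ2.Theses.ModulusResponse
import Summits.CriticalPhenomena.CardyFormulaZ2.Theorems.ModulusResponseSmirnovCellAnchor
import Literature.Probability.RandomPlanarGeometry.ConformalRectangleProofs
import HarnessLib

/-!
# Stub `stub_anchorLimits` of line `registered` (crux stmt-CriticalPhenomena-6468 `SmirnovResponse`):
# the `u = 0` crossing probabilities of every stretched conformal rectangle converge

For the pinned cell family `μ_u` and the pinned diagonal stretches
`S_t z = cosh t · z + i sinh t · z̄`, at `u = 0` the crossing probability
`μ_0[cross_δ S_s R]` of the stretched conformal rectangle `S_s R` converges as the mesh `δ → 0⁺`,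
for EVERY stretch `s` and every conformal rectangle `R` (so that the `limUnder` in the crux
`SmirnovResponse` is an honest limit).

Proof. Smirnov's theorem in the `ℤ²`-cell frame is in tree for the one stretch
`t₀ = -(log 3)/4` and all conformal rectangles (`smirnovCellAnchor_proof : SmirnovCellAnchor`).
The stretches form a one-parameter group, `S_a ∘ S_b = S_{a+b}` (addition formulas for `cosh`,
`sinh`), so `S_s R = S_{t₀} (S_{s-t₀} R)`, where `R' = S_{s-t₀} R` is again a conformal rectangle
(`MarkedDomain.map` by the plane homeomorphism `S_{s-t₀}`, inverse `S_{t₀-s}`), with the arcs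
transported accordingly (`MarkedDomain.arc_map`). A uniformizing datum of `R'` exists
(`MarkedDomain.exists_isUniformizing_holds`), and `smirnovCellAnchor_proof` applied to `R'` and this
datum is the required convergence (to Cardy's function of the cross-ratio of the datum).
-/

noncomputable section

namespace Summit.CriticalPhenomena.CardyFormulaZ2.Theorems

open Set Filter Topology MeasureTheory
open Literature.Probability.LatticeModels Literature.Probability.RandomPlanarGeometry
  Literature.Probability.Percolation
open scoped ComplexConjugate

/-- **Anchor limits** (stub `stub_anchorLimits` of the birth line of crux `SmirnovResponse`): for
the pinned cell family `μ` and pinned stretches `S`, the `u = 0` crossing probability of every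
stretched conformal rectangle `S_s R` converges as the mesh `δ → 0⁺` — Smirnov's theorem at the
anchor stretch `t₀ = -(log 3)/4` (`smirnovCellAnchor_proof`) transported to all `s` through the
group law `S_s = S_{t₀} ∘ S_{s-t₀}` and `MarkedDomain.map`.
[cite: Smirnov2001, Thm. 1] [cite: BollobasRiordan2006, Ch. 7 Thm. 2] -/
theorem stub_anchorLimits :
    ∀ (μ : ℝ → MeasureTheory.Measure (Literature.Probability.Percolation.BondConfig (Literature.Probability.LatticeModels.Site 2))) (S : ℝ → ℂ → ℂ), (∀ u, μ u = MeasureTheory.Measure.map (fun p : Set (Literature.Probability.LatticeModels.Site 2) × Set (Literature.Probability.LatticeModels.Site 2) ↦ {e | ∃ m, (m ∈ p.1 ∧ e = s(m - Pi.single 0 1, m)) ∨ ((m ∈ p.1 ↔ m ∉ p.2) ∧ e = s(m - Pi.single 1 1, m))}) ((ProbabilityTheory.setBernoulli Set.univ Literature.Probability.Percolation.half).prod (ProbabilityTheory.setBernoulli Set.univ (Set.projIcc 0 1 zero_le_one u)))) → (∀ t z, S t z = (Real.cosh t : ℂ) * z + Complex.I * (Real.sinh t : ℂ) * (starRingEnd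 ℂ) z) → ∀ (R : Literature.Probability.RandomPlanarGeometry.ConformalRectangle) (s : ℝ), ∃ P : ℝ, Filter.Tendsto (fun δ ↦ (μ 0).real (Literature.Probability.Percolation.discreteCrossing (S s '' R.carrier) δ (S s '' R.arc 0) (S s '' R.arc 2))) (nhdsWithin 0 (Set.Ioi 0)) (nhds P) := by
  intro μ S hμ hS R s
  classical
  set τ : ℝ := -(Real.log 3) / 4 with hτ
  -- the stretches form a one-parameter group of plane homeomorphisms
  have hcomp : ∀ a b z, S a (S b z) = S (a + b) z := by
    intro a b z
    rw [hS, hS, hS, Real.cosh_add, Real.sinh_add]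
    simp only [map_add, map_mul, Complex.conj_ofReal, Complex.conj_I, Complex.conj_conj]
    push_cast
    ring_nf
    rw [Complex.I_sq]
    ring
  have hS0 : ∀ z, S 0 z = z := fun z => by rw [hS]; simp
  have hScont : ∀ t, Continuous (S t) := fun t => by
    have : S t = fun z => (Real.cosh t : ℂ) * z + Complex.I * (Real.sinh t : ℂ) * (starRingEnd ℂ) z :=
      funext (hS t)
    rw [this]; fun_prop
  -- the relative stretch `S_{s - τ}` as a plane homeomorphism, and the rectangle `R' = S_{s - τ} R`
  let Th : ℂ ≃ₜ ℂ :=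
    { toFun := S (s - τ)
      invFun := S (τ - s)
      left_inv := fun z => by
        show S (τ - s) (S (s - τ) z) = z
        rw [hcomp, sub_add_sub_cancel, sub_self, hS0]
      right_inv := fun z => by
        show S (s - τ) (S (τ - s) z) = z
        rw [hcomp, sub_add_sub_cancel, sub_self, hS0]
      continuous_toFun := hScont _
      continuous_invFun := hScont _ }
  set R' : ConformalRectangle := R.map Th with hR'
  have himg : ∀ A : Set ℂ, S τ '' (S (s - τ) '' A) = S s '' A := fun A => by
    rw [Set.image_image]
    refine Set.image_congr fun z _ => ?_
    rw [hcomp, show τ + (s - τ) = s by ring]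
  have hR'c : S τ '' R'.carrier = S s '' R.carrier := himg _
  have hR'arc : ∀ i, S τ '' R'.arc i = S s '' R.arc i := fun i => by
    rw [hR', MarkedDomain.arc_map]
    exact himg _
  -- a uniformizing datum of `R'`, and Smirnov's theorem at the anchor stretch for `R'`
  obtain ⟨φ, x, hφx⟩ := MarkedDomain.exists_isUniformizing_holds R'
  have h : Tendsto (fun δ ↦ (μ 0).real (discreteCrossing (S τ '' R'.carrier) δ (S τ '' R'.arc 0)
      (S τ '' R'.arc 2))) (𝓝[>] 0)
      (𝓝 (Literature.Probability.RandomPlanarGeometry.cardyFunction (crossRatio x))) :=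
    smirnovCellAnchor_proof μ S hμ hS R' φ x hφx
  rw [hR'c, hR'arc 0, hR'arc 2] at h
  exact ⟨_, h⟩

end Summit.CriticalPhenomena.CardyFormulaZ2.Theorems

end
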